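import Literature.NumberTheory.Sieve.RoughOmegaCellsLocalAPPrep
import HarnessLib

/-!
# Ω-cells of the rough integers in a progression at scale `N`: the local law

Topic `Literature/NumberTheory/Sieve`. Everything here is PROVED. Fix `u ≥ 2`, `L ≥ 1`, `j = i + 1 ≥ 1`
and put `z = N^{1/u}`, `T = ⌊z⌋ + 1`; the `z`-rough `Ω = j` numbers are
`Φ_j(V) = #{v ∈ roughIcc T V : Ω v = j}` and in a class `Φ_j(V; q, r) = #{… , v ≡ r (q)}`. The MODEL
density at scale `N` is `A_j(N)/N = Φ_j(N)/N` (`∼ I_j(u)/log N`, Alladi). The theorem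
`exists_forall_abs_cellClass_segment_sub_le` is the **local law**

> `Φ_j(V₂; q, r) − Φ_j(V₁; q, r) = ((V₂ − V₁)/φ(q)) · A_j(N)/N + O(N/(log N (log log N)^B))`

for all `N ≥ N₀(u, L, B, j)`, uniformly in `q ≤ L`, `(r, q) = 1` and `0 ≤ V₁ ≤ V₂ ≤ L N`, for every `B`:
rough almost-primes of a fixed cell are, at scale `N`, uniformly distributed in the reduced classes to
bounded moduli AND along segments, with the density of the model interval `[1, N]`. Its two inputs are
taken as HYPOTHESES, in the exact shape in which the tree proves them:

* `hP1` — Alladi's asymptotic with a rate for the cell `Ω = j`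
  (`exists_abs_roughCell_sub_main_le`, `RoughOmegaCellsAsymptoticDensity.lean`);
* `hP3` — equidistribution of the cell in the reduced classes mod `q ≤ L`
  (`RoughCellsAP.exists_abs_cellClassDisc_le`, `RoughOmegaCellsClassesEquidistribution.lean`).

The proof is bookkeeping (`RoughOmegaCellsLocalAPPrep.lean` has the tools): the class counts are
`Φ_j(V)/φ(q) + O(V/log² z)`; and `Φ_j(V) − V A_j(N)/N = O(N log log N/log² N)` uniformly for
`V ≤ L N`, because `V ↦ V I_j(log V/log T)/log V` has slope `I_j(u)/log N + O(log log N/log² N)` on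
`[N/log² N, L N]` (the densities `I_j` are `1`-Lipschitz). Sub-namespace `RoughCellsLocal`.

## References

* K. Alladi, *The distribution of ν(n) in the sieve of Eratosthenes*, Quart. J. Math. Oxford (2) 33
  (1982), 129–148. [Alladi1982]
* G. Tenenbaum, *Introduction to analytic and probabilistic number theory*, Ch. III.6. [Tenenbaum2015]
-/

open Finset Filter Asymptotics
open scoped Topology ArithmeticFunction.Omega

noncomputable section

namespace Literature.NumberTheory.Sieve

namespace RoughCellsLocal

/-- **The local law for the `Ω`-cells of the rough integers in progressions, at scale `N`.** Fix
`u ≥ 2`, `L ≥ 1`, `j = i + 1` and `B`. Assume Alladi's asymptotic with a rate for the cell `Ω = j` in the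
range `log X ≤ (u+1) log Y` (`hP1`, proved in `RoughOmegaCellsAsymptoticDensity.lean`) and the
equidistribution of this cell in the reduced classes to every modulus `q ≤ L` in the same range (`hP3`,
proved in `RoughOmegaCellsClassesEquidistribution.lean`). Then there is `N₀` such that for all
`N ≥ N₀`, all `q ≤ L`, `(r, q) = 1` and all `V₁ ≤ V₂ ≤ L N`, with `T = ⌊N^{1/u}⌋ + 1`,
`|Φ_j(V₂; q, r) − Φ_j(V₁; q, r) − ((V₂ − V₁)/φ(q)) · Φ_j(N)/N| ≤ N/(log N (log log N)^B)`,
where `Φ_j(V; q, r) = #{v ∈ roughIcc T V : Ω v = j, v ≡ r (q)}` and `Φ_j(V) = #{v ∈ roughIcc T V : Ω v = j}`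
(Landau–Selberg–Delange / Alladi folklore: the rough almost-primes of one cell are locally uniformly
distributed, in classes and along segments, at the density of the model interval). [folklore] -/
theorem exists_forall_abs_cellClass_segment_sub_le {i u : ℕ} (L B : ℕ) (hu : 2 ≤ u) (hL : 1 ≤ L)
    {C₁ : ℝ} (hC₁ : 0 ≤ C₁)
    (hP1 : ∀ X Y : ℝ, 2 ≤ Y → Y ≤ X → Real.log X ≤ (u + 1 : ℕ) * Real.log Y →
      |(#((roughIcc ⌈Y⌉₊ ⌊X⌋₊).filter (fun b => Ω b = i + 1)) : ℝ) -
        (X * roughCellDensity (i + 1) (Real.log X / Real.log Y) / Real.log X -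
          if i = 0 then Y / Real.log Y else 0)| ≤ C₁ * X / Real.log Y ^ 2)
    (hP3 : ∀ q : ℕ, 0 < q → q ≤ L → ∃ C : ℝ, 0 ≤ C ∧ ∀ X Y : ℝ, 2 ≤ Y → Y ≤ X →
      Real.log X ≤ (u + 1 : ℕ) * Real.log Y → (q : ℝ) < Y → ∀ c : ℕ, c.Coprime q →
        |(#((roughIcc ⌈Y⌉₊ ⌊X⌋₊).filter (fun b => Ω b = i + 1 ∧ b ≡ c [MOD q])) : ℝ) -
            (#((roughIcc ⌈Y⌉₊ ⌊X⌋₊).filter (fun b => Ω b = i + 1)) : ℝ) / Nat.totient q| ≤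
          C * X / Real.log Y ^ 2) :
    ∃ N₀ : ℕ, ∀ N : ℕ, N₀ ≤ N → ∀ q : ℕ, 0 < q → q ≤ L → ∀ r : ℕ, r.Coprime q →
      ∀ V₁ V₂ : ℕ, V₁ ≤ V₂ → V₂ ≤ L * N →
        |(#((roughIcc (⌊(N : ℝ) ^ ((1 : ℝ) / u)⌋₊ + 1) V₂).filter
              (fun v => Ω v = i + 1 ∧ v ≡ r [MOD q])) : ℝ) -
            #((roughIcc (⌊(N : ℝ) ^ ((1 : ℝ) / u)⌋₊ + 1) V₁).filter
              (fun v => Ω v = i + 1 ∧ v ≡ r [MOD q])) -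
            ((V₂ : ℝ) - V₁) / Nat.totient q *
              ((#((roughIcc (⌊(N : ℝ) ^ ((1 : ℝ) / u)⌋₊ + 1) N).filter
                (fun v => Ω v = i + 1)) : ℝ) / N)| ≤
          (N : ℝ) / (Real.log N * Real.log (Real.log N) ^ B) := by
  -- a uniform constant for the moduli `q ≤ L`
  obtain ⟨C₃, hC₃, hP3'⟩ : ∃ C₃ : ℝ, 0 ≤ C₃ ∧ ∀ q : ℕ, 0 < q → q ≤ L → ∀ X Y : ℝ, 2 ≤ Y → Y ≤ X →
      Real.log X ≤ (u + 1 : ℕ) * Real.log Y → (q : ℝ) < Y → ∀ c : ℕ, c.Coprime q →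
        |(#((roughIcc ⌈Y⌉₊ ⌊X⌋₊).filter (fun b => Ω b = i + 1 ∧ b ≡ c [MOD q])) : ℝ) -
            (#((roughIcc ⌈Y⌉₊ ⌊X⌋₊).filter (fun b => Ω b = i + 1)) : ℝ) / Nat.totient q| ≤
          C₃ * X / Real.log Y ^ 2 := by
    classical
    choose! C hC0 hC using hP3
    refine ⟨∑ q ∈ Finset.Icc 1 L, C q, Finset.sum_nonneg fun q hq => ?_, fun q hq hqL X Y hY hYX hXY hqY c hc => ?_⟩
    · rw [Finset.mem_Icc] at hq; exact hC0 q hq.1 hq.2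
    · refine (hC q hq hqL X Y hY hYX hXY hqY c hc).trans ?_
      have hX : 0 ≤ X := by linarith
      have hle : C q ≤ ∑ q ∈ Finset.Icc 1 L, C q :=
        Finset.single_le_sum (fun q' hq' => by rw [Finset.mem_Icc] at hq'; exact hC0 q' hq'.1 hq'.2)
          (Finset.mem_Icc.mpr ⟨hq, hqL⟩)
      rw [div_le_div_iff_of_pos_right (by have := Real.log_pos (by linarith : (1:ℝ) < Y); positivity)]
      exact mul_le_mul_of_nonneg_right hle hX
  -- the constants
  have hu0 : (0 : ℝ) < u := by exact_mod_cast (by omega : 0 < u)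
  have hu1 : (1 : ℝ) ≤ u := by exact_mod_cast (by omega : 1 ≤ u)
  have hL1 : (1 : ℝ) ≤ L := by exact_mod_cast hL
  have hL0 : (0 : ℝ) ≤ L := by linarith
  have hlogL : 0 ≤ Real.log L := Real.log_nonneg hL1
  set Kδ : ℝ := 2 * C₁ * L * u ^ 2 + 12 * u * L + L + 1 with hKδ
  have hu2 : (2 : ℝ) ≤ u := by exact_mod_cast hu
  have hKδ2 : 2 ≤ Kδ := by
    have h1 : (24 : ℝ) ≤ 12 * u * L := by nlinarith
    have h2 : 0 ≤ 2 * C₁ * L * u ^ 2 := by positivity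
    linarith
  set K : ℝ := 2 * C₃ * L * u ^ 2 + 2 * Kδ with hK
  have hK0 : 0 < K := by
    have h1 : 0 ≤ 2 * C₃ * L * u ^ 2 := by positivity
    linarith
  -- the eventual conditions on `N`
  have hc1 : ∀ᶠ N : ℕ in atTop, 1 ≤ Real.log (Real.log N) ∧ Real.log L ≤ Real.log (Real.log N) := by
    have ht := (Real.tendsto_log_atTop.comp Real.tendsto_log_atTop).comp tendsto_natCast_atTop_atTop
    exact (ht.eventually_ge_atTop 1).and (ht.eventually_ge_atTop (Real.log L))
  have hc2 : ∀ᶠ N : ℕ in atTop, max (L : ℝ) (Real.exp 1) < (N : ℝ) ^ ((1 : ℝ) / u) :=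
    ((tendsto_rpow_atTop (by positivity)).comp tendsto_natCast_atTop_atTop).eventually_gt_atTop _
  have hc3 := eventually_rpow_le_div_log_sq hu
  have hc4 := eventually_mul_loglog_pow_le_log (4 + 2 * Real.log L) 1
  have hc5 := eventually_mul_loglog_pow_le_log K (B + 1)
  obtain ⟨N₀, hN₀⟩ := Filter.eventually_atTop.1
    (hc1.and (hc2.and (hc3.and (hc4.and (hc5.and (eventually_ge_atTop 3))))))
  refine ⟨N₀, fun N hN q hq hqL r hr V₁ V₂ hV₁₂ hV₂ => ?_⟩
  obtain ⟨⟨hll, hLll⟩, hLz, hzN, hc4N, hc5N, hN3⟩ := hN₀ N hN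
  rw [pow_one] at hc4N
  -- notation
  set z : ℝ := (N : ℝ) ^ ((1 : ℝ) / u) with hz
  set T : ℕ := ⌊z⌋₊ + 1 with hT
  set Y : ℝ := (T : ℝ) with hY
  set ℓ : ℝ := Real.log Y with hℓ
  set lN : ℝ := Real.log N with hlN
  set F : ℝ → ℝ := roughCellDensity (i + 1) with hF
  set Φ : ℕ → ℝ := fun V => (#((roughIcc T V).filter (fun v => Ω v = i + 1)) : ℝ) with hΦ
  set Φr : ℕ → ℝ := fun V => (#((roughIcc T V).filter (fun v => Ω v = i + 1 ∧ v ≡ r [MOD q])) : ℝ)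
    with hΦr
  set A : ℝ := Φ N with hA
  -- basic numerics
  have hLz' : (L : ℝ) < z := lt_of_le_of_lt (le_max_left _ _) hLz
  have hez : Real.exp 1 < z := lt_of_le_of_lt (le_max_right _ _) hLz
  have he1 : (2 : ℝ) ≤ Real.exp 1 := by have := Real.add_one_le_exp (1 : ℝ); linarith
  have hz2 : 2 < z := by linarith
  have hz0 : 0 < z := by linarith
  have hzY : z < Y := by rw [hY, hT]; push_cast; exact Nat.lt_floor_add_one z
  have hYz : Y ≤ z + 1 := by
    rw [hY, hT]; push_cast; linarith [Nat.floor_le hz0.le]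
  have hY2 : 2 ≤ Y := by linarith
  have hY0 : 0 < Y := by linarith
  have hT2 : 2 ≤ T := by exact_mod_cast (show (2 : ℝ) ≤ (T : ℝ) from hY2)
  have hT1 : 1 ≤ T := by omega
  have hN3' : (3 : ℝ) ≤ N := by exact_mod_cast hN3
  have hN0 : (0 : ℝ) < N := by linarith
  have hlogN1 : 1 ≤ lN := by
    rw [hlN, Real.le_log_iff_exp_le hN0]
    linarith [Real.exp_one_lt_d9]
  have hlogN0 : 0 < lN := by linarith
  have hlogz : Real.log z = lN / u := by
    rw [hz, Real.log_rpow hN0]; ring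
  have hℓz : Real.log z < ℓ := Real.log_lt_log hz0 hzY
  have hℓ_gt : lN / u < ℓ := hlogz ▸ hℓz
  have hℓ1 : 1 < ℓ := by
    have : Real.log (Real.exp 1) < Real.log z := Real.log_lt_log (Real.exp_pos 1) hez
    rw [Real.log_exp] at this
    linarith
  have hℓ0 : 0 < ℓ := by linarith
  have hlNuℓ : lN ≤ u * ℓ := by
    have := (div_lt_iff₀' hu0).mp hℓ_gt
    linarith
  have hℓinv : 1 / ℓ ≤ u / lN := by
    rw [div_le_div_iff₀ hℓ0 hlogN0]; linarith
  have hℓinv2 : 1 / ℓ ^ 2 ≤ u ^ 2 / lN ^ 2 := by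
    rw [div_le_div_iff₀ (by positivity) (by positivity), one_mul, ← mul_pow]
    exact pow_le_pow_left₀ hlogN0.le hlNuℓ 2
  have hYN : Y ≤ N / lN ^ 2 := by linarith
  have hNlN : (N : ℝ) / lN ^ 2 ≤ N := div_le_self hN0.le (one_le_pow₀ hlogN1)
  have hYN' : Y ≤ N := hYN.trans hNlN
  have hTN : T ≤ N := by exact_mod_cast (show (T : ℝ) ≤ (N : ℝ) from hYN')
  have hLN0 : (0 : ℝ) < L * N := by positivity
  have hqY : (q : ℝ) < Y := by
    have : (q : ℝ) ≤ L := by exact_mod_cast hqL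
    linarith
  -- `log V ≤ (u + 1) log Y` for `1 ≤ V ≤ L N`
  have hlogV_le : ∀ V : ℕ, 1 ≤ V → (V : ℝ) ≤ L * N → Real.log V ≤ ((u + 1 : ℕ) : ℝ) * ℓ := by
    intro V hV1 hVL
    have hV0 : (0 : ℝ) < V := by exact_mod_cast hV1
    have h1 : Real.log V ≤ Real.log L + lN := by
      rw [hlN, ← Real.log_mul (by positivity) hN0.ne']
      exact Real.log_le_log hV0 hVL
    have h2 : Real.log L < lN / u := by
      rw [← hlogz]; exact Real.log_lt_log (by positivity) hLz'
    have h3 : lN / u + lN = (u + 1) * (lN / u) := by field_simp; ring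
    have h4 : (u + 1 : ℝ) * (lN / u) ≤ (u + 1) * ℓ := mul_le_mul_of_nonneg_left hℓ_gt.le (by positivity)
    push_cast
    linarith
  -- the secondary term of the cell `Ω = 1`
  set s : ℝ := (if i = 0 then Y / ℓ else 0) with hs_def
  have hs0 : 0 ≤ s := by
    rw [hs_def]; split_ifs
    · positivity
    · exact le_rfl
  have hsY : s ≤ Y := by
    rw [hs_def]; split_ifs
    · exact div_le_self hY0.le hℓ1.le
    · exact hY0.le
  -- the two inputs at the integer points `(V, T)`
  have hP1w : ∀ V : ℕ, T ≤ V → (V : ℝ) ≤ L * N →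
      |Φ V - ((V : ℝ) * F (Real.log V / ℓ) / Real.log V - s)| ≤ C₁ * V / ℓ ^ 2 := by
    intro V hTV hVL
    have hYV : Y ≤ (V : ℝ) := by rw [hY]; exact_mod_cast hTV
    have h := hP1 (V : ℝ) Y hY2 hYV (hlogV_le V (by omega) hVL)
    rw [hY, Nat.ceil_natCast, Nat.floor_natCast] at h
    exact h
  have hP3w : ∀ V : ℕ, T ≤ V → (V : ℝ) ≤ L * N → |Φr V - Φ V / Nat.totient q| ≤ C₃ * V / ℓ ^ 2 := by
    intro V hTV hVL
    have hYV : Y ≤ (V : ℝ) := by rw [hY]; exact_mod_cast hTV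
    have h := hP3' q hq hqL (V : ℝ) Y hY2 hYV (hlogV_le V (by omega) hVL) hqY r hr
    rw [hY, Nat.ceil_natCast, Nat.floor_natCast] at h
    exact h
  -- trivial facts about the counts
  have hφ1 : (1 : ℝ) ≤ Nat.totient q := by exact_mod_cast Nat.totient_pos.mpr hq
  have hΦ_le : ∀ V : ℕ, Φ V ≤ V := fun V => by
    simp only [hΦ]
    exact_mod_cast card_roughIcc_filter_cardFactors_le T V (i + 1)
  have hΦ0 : ∀ V : ℕ, 0 ≤ Φ V := fun V => Nat.cast_nonneg _
  have hΦr0 : ∀ V : ℕ, 0 ≤ Φr V := fun V => Nat.cast_nonneg _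
  have hΦr_le : ∀ V : ℕ, Φr V ≤ Φ V := fun V => by
    simp only [hΦ, hΦr]
    exact_mod_cast Finset.card_le_card (filter_cellClass_subset T V i q r)
  have hzero : ∀ V : ℕ, V < T → Φ V = 0 ∧ Φr V = 0 := by
    intro V hVT
    have h1 : Φ V = 0 := by
      simp only [hΦ, filter_cell_eq_empty_of_lt hT1 hVT i, Finset.card_empty, Nat.cast_zero]
    refine ⟨h1, le_antisymm ?_ (hΦr0 V)⟩
    exact (hΦr_le V).trans h1.le
  have hA_le : A ≤ N := hΦ_le N
  have hA0 : 0 ≤ A := hΦ0 N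
  have hNLN : (N : ℝ) ≤ L * N := le_mul_of_one_le_left hN0.le hL1
  -- Step A1: the model density `A/N` against `λ = F(u_N)/log N`
  set lam : ℝ := F (lN / ℓ) / lN with hlam
  have hA1 : |A - N * lam| ≤ C₁ * N / ℓ ^ 2 + Y := by
    have h : |Φ N - ((N : ℝ) * F (lN / ℓ) / lN - s)| ≤ C₁ * N / ℓ ^ 2 := hP1w N hTN hNLN
    have e : A - N * lam = (Φ N - ((N : ℝ) * F (lN / ℓ) / lN - s)) - s := by
      rw [hA, hlam]; ring
    rw [e]
    calc |(Φ N - ((N : ℝ) * F (lN / ℓ) / lN - s)) - s|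
        ≤ |Φ N - ((N : ℝ) * F (lN / ℓ) / lN - s)| + |s| := abs_sub _ _
      _ ≤ C₁ * N / ℓ ^ 2 + Y := add_le_add h (by rw [abs_of_nonneg hs0]; exact hsY)
  have huN1 : 1 ≤ lN / ℓ := by
    rw [le_div_iff₀ hℓ0, one_mul]
    exact Real.log_le_log hY0 hYN'
  have hFuN0 : 0 ≤ F (lN / ℓ) := roughCellDensity_nonneg _ _
  have hFuN : F (lN / ℓ) ≤ u := by
    refine (roughCellDensity_le (by omega) huN1).trans ?_
    rw [div_le_iff₀ hℓ0]
    exact hlNuℓ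
  have hlam0 : 0 ≤ lam := by positivity
  -- freeze the counting functions (no unfolding below this point)
  change |Φr V₂ - Φr V₁ - ((V₂ : ℝ) - V₁) / (Nat.totient q : ℝ) * (A / N)| ≤
    (N : ℝ) / (lN * Real.log lN ^ B)
  have hNne : (N : ℝ) ≠ 0 := hN0.ne'
  clear_value Φ Φr A lam s F ℓ Y T z lN
  -- Step A: `|Φ(V) − V A/N| ≤ δ` for all `V ≤ L N`
  set δ : ℝ := Kδ * N * Real.log lN / lN ^ 2 with hδ
  have hNlN2 : 0 < (N : ℝ) / lN ^ 2 := by positivity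
  have hG : ∀ V : ℕ, (V : ℝ) ≤ L * N → |Φ V - V * A / N| ≤ δ := by
    intro V hVL
    have hV0 : (0 : ℝ) ≤ V := Nat.cast_nonneg V
    rcases le_or_gt (V : ℝ) (N / lN ^ 2) with hsmall | hlarge
    · -- small `V`: both terms are `≤ V ≤ N/log² N`
      have h1 : (V : ℝ) * A / N ≤ V := by
        rw [mul_div_assoc]
        exact mul_le_of_le_one_right hV0 ((div_le_one hN0).mpr hA_le)
      have h2 : 0 ≤ (V : ℝ) * A / N := by positivity
      have h3 : |Φ V - V * A / N| ≤ 2 * (N / lN ^ 2) := by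
        rw [abs_le]; constructor <;> linarith [hΦ_le V, hΦ0 V]
      refine h3.trans ?_
      rw [hδ]
      have : 2 * ((N : ℝ) / lN ^ 2) = 2 * N / lN ^ 2 := by ring
      rw [this, div_le_div_iff_of_pos_right (by positivity)]
      have h4 : (2 : ℝ) ≤ Kδ * Real.log lN := by
        calc (2 : ℝ) = 2 * 1 := by ring
          _ ≤ Kδ * Real.log lN := mul_le_mul hKδ2 hll zero_le_one (by linarith)
      calc (2 : ℝ) * N ≤ Kδ * Real.log lN * N := mul_le_mul_of_nonneg_right h4 hN0.le
        _ = Kδ * N * Real.log lN := by ring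
    · -- large `V`: Alladi at `(V, T)` and the Lipschitz bound
      have hYV : Y < (V : ℝ) := lt_of_le_of_lt hYN hlarge
      have hTV : T ≤ V := by
        have h : (T : ℝ) ≤ V := hY ▸ hYV.le
        exact_mod_cast h
      have hV1 : (1 : ℝ) ≤ V := by linarith
      have hVpos : (0 : ℝ) < V := by linarith
      set lV : ℝ := Real.log V with hlV
      set Δ : ℝ := 2 * Real.log lN + Real.log L with hΔ
      have hΔ3 : Δ ≤ 3 * Real.log lN := by rw [hΔ]; linarith
      have hΔ0 : 0 ≤ Δ := by rw [hΔ]; positivity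
      have hΔhalf : Δ ≤ lN / 2 := by
        rw [hΔ]
        have h1 : 2 * Real.log L * 1 ≤ 2 * Real.log L * Real.log lN :=
          mul_le_mul_of_nonneg_left hll (by positivity)
        rw [mul_one] at h1
        have h2 : (4 + 2 * Real.log L) * Real.log lN = 4 * Real.log lN + 2 * Real.log L * Real.log lN := by
          ring
        linarith
      -- `log V` against `log N`
      have hlV_lo : lN - 2 * Real.log lN ≤ lV := by
        have h1 : Real.log ((N : ℝ) / lN ^ 2) ≤ lV := Real.log_le_log hNlN2 hlarge.le
        rw [Real.log_div hNne (by positivity), Real.log_pow, ← hlN] at h1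
        push_cast at h1
        linarith
      have hlV_hi : lV ≤ Real.log L + lN := by
        rw [hlV, hlN, ← Real.log_mul (by positivity) hN0.ne']
        exact Real.log_le_log hVpos hVL
      have hlVN : |lV - lN| ≤ Δ := by
        rw [abs_le, hΔ]; constructor <;> linarith
      have hlV_half : lN / 2 ≤ lV := by linarith
      have hlV0 : 0 < lV := by linarith
      -- the two density arguments
      have huV1 : 1 ≤ lV / ℓ := by
        rw [le_div_iff₀ hℓ0, one_mul, hℓ, hlV]
        exact Real.log_le_log hY0 hYV.le
      have hdu : |lV / ℓ - lN / ℓ| ≤ Δ / ℓ := by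
        rw [← sub_div, abs_div, abs_of_pos hℓ0]
        exact div_le_div_of_nonneg_right hlVN hℓ0.le
      -- `|F(u_V) − F(u_N)| ≤ Δ/ℓ` (`F` is `1`-Lipschitz on `[1, ∞)`)
      have hFdiff : |F (lV / ℓ) - F (lN / ℓ)| ≤ Δ / ℓ := by
        rcases le_total (lV / ℓ) (lN / ℓ) with hle | hle
        · have h1 := roughCellDensity_sub_le_sub (j := i + 1) (by omega) huV1 hle
          have h2 := monotone_roughCellDensity (i + 1) hle
          rw [abs_sub_comm, abs_of_nonneg (by simp only [hF] at h2 ⊢; linarith)]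
          rw [abs_le] at hdu
          simp only [hF] at h1 ⊢
          linarith
        · have h1 := roughCellDensity_sub_le_sub (j := i + 1) (by omega) huN1 hle
          have h2 := monotone_roughCellDensity (i + 1) hle
          rw [abs_of_nonneg (by simp only [hF] at h2 ⊢; linarith)]
          rw [abs_le] at hdu
          simp only [hF] at h1 ⊢
          linarith
      -- Step A as real arithmetic
      have hE1 : |Φ V - ((V : ℝ) * F (lV / ℓ) / lV - s)| ≤ C₁ * V / ℓ ^ 2 := hP1w V hTV hVL
      have h := abs_cell_sub_linear_le_of hC₁ hL0 hu0 hN0 hV0 hVL hlogN0 hℓ0 hℓinv hℓinv2 hlV0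
        hlV_half hlVN hΔ0 hΔ3 hll hYN hs0 hsY hFdiff hFuN0 hFuN hlam hE1 hA1
      rw [hδ, hKδ]
      exact h
  -- Step B: the class discrepancies and the assembly (explicit terms only: the context is large)
  have hu20 : (0 : ℝ) ≤ u ^ 2 := pow_nonneg hu0.le 2
  have hD : ∀ V : ℕ, (V : ℝ) ≤ L * N → |Φr V - Φ V / Nat.totient q| ≤ C₃ * L * u ^ 2 * (N / lN ^ 2) := by
    intro V hVL
    rcases lt_or_ge V T with hVT | hTV
    · obtain ⟨h1, h2⟩ := hzero V hVT
      rw [h1, h2, zero_div, sub_zero, abs_zero]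
      exact mul_nonneg (mul_nonneg (mul_nonneg hC₃ hL0) hu20) hNlN2.le
    · refine (hP3w V hTV hVL).trans ?_
      have hV0 : (0 : ℝ) ≤ V := Nat.cast_nonneg V
      calc C₃ * V / ℓ ^ 2 = C₃ * V * (1 / ℓ ^ 2) := by ring
        _ ≤ C₃ * (L * N) * (u ^ 2 / lN ^ 2) :=
            mul_le_mul (mul_le_mul_of_nonneg_left hVL hC₃) hℓinv2
              (div_nonneg zero_le_one (pow_nonneg hℓ0.le 2)) (mul_nonneg hC₃ hLN0.le)
        _ = C₃ * L * u ^ 2 * (N / lN ^ 2) := by ring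
  have hV₂L : (V₂ : ℝ) ≤ L * N := by exact_mod_cast hV₂
  have hV₁L : (V₁ : ℝ) ≤ L * N := le_trans (by exact_mod_cast hV₁₂) hV₂L
  have hmain : |Φr V₂ - Φr V₁ - ((V₂ : ℝ) - V₁) / Nat.totient q * (A / N)| ≤
      K * N * Real.log lN / lN ^ 2 := by
    have e : Φr V₂ - Φr V₁ - ((V₂ : ℝ) - V₁) / Nat.totient q * (A / N) =
        (Φr V₂ - Φ V₂ / Nat.totient q) - (Φr V₁ - Φ V₁ / Nat.totient q) +
          ((Φ V₂ - V₂ * A / N) - (Φ V₁ - V₁ * A / N)) / Nat.totient q := by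
      ring
    rw [e]
    have hφ0 : (0 : ℝ) < Nat.totient q := lt_of_lt_of_le one_pos hφ1
    have h3 : |((Φ V₂ - V₂ * A / N) - (Φ V₁ - V₁ * A / N)) / Nat.totient q| ≤ δ + δ := by
      rw [abs_div, abs_of_pos hφ0]
      refine (div_le_self (abs_nonneg _) hφ1).trans ?_
      exact (abs_sub _ _).trans (add_le_add (hG V₂ hV₂L) (hG V₁ hV₁L))
    have h4 : 2 * C₃ * L * u ^ 2 * 1 ≤ 2 * C₃ * L * u ^ 2 * Real.log lN :=
      mul_le_mul_of_nonneg_left hll (mul_nonneg (mul_nonneg (mul_nonneg zero_le_two hC₃) hL0) hu20)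
    rw [mul_one] at h4
    calc _ ≤ |Φr V₂ - Φ V₂ / Nat.totient q| + |Φr V₁ - Φ V₁ / Nat.totient q| +
          |((Φ V₂ - V₂ * A / N) - (Φ V₁ - V₁ * A / N)) / Nat.totient q| :=
          (abs_add_le _ _).trans (add_le_add (abs_sub _ _) le_rfl)
      _ ≤ C₃ * L * u ^ 2 * (N / lN ^ 2) + C₃ * L * u ^ 2 * (N / lN ^ 2) + (δ + δ) :=
          add_le_add (add_le_add (hD V₂ hV₂L) (hD V₁ hV₁L)) h3
      _ = (2 * C₃ * L * u ^ 2 + 2 * Kδ * Real.log lN) * (N / lN ^ 2) := by rw [hδ]; ring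
      _ ≤ (2 * C₃ * L * u ^ 2 * Real.log lN + 2 * Kδ * Real.log lN) * (N / lN ^ 2) :=
          mul_le_mul_of_nonneg_right (add_le_add h4 le_rfl) hNlN2.le
      _ = K * N * Real.log lN / lN ^ 2 := by rw [hK]; ring
  -- Step C: `K N log log N/log² N ≤ N/(log N (log log N)^B)`
  have hll0 : 0 < Real.log lN := lt_of_lt_of_le one_pos hll
  have hfinal : K * N * Real.log lN / lN ^ 2 ≤ (N : ℝ) / (lN * Real.log lN ^ B) := by
    rw [div_le_div_iff₀ (pow_pos hlogN0 2) (mul_pos hlogN0 (pow_pos hll0 B))]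
    have h1 : K * Real.log lN ^ (B + 1) * (N * lN) ≤ lN * (N * lN) :=
      mul_le_mul_of_nonneg_right hc5N (mul_pos hN0 hlogN0).le
    calc K * N * Real.log lN * (lN * Real.log lN ^ B) = K * Real.log lN ^ (B + 1) * (N * lN) := by
          ring
      _ ≤ lN * (N * lN) := h1
      _ = N * lN ^ 2 := by ring
  exact hmain.trans hfinal

end RoughCellsLocal

end Literature.NumberTheory.Sieve
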